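import Literature.Probability.RandomPlanarGeometry.SAWWords
import HarnessLib

/-!
# Counting words that survive a pruning automaton (Collatz–Wielandt bound)

Topic `Literature/Probability/RandomPlanarGeometry` (continues `SAWWords.lean`). The abstract
counting lemma behind the finite-memory upper bounds for the connective constant
(Pönitz–Tittmann 2000; Alm 1993): a deterministic automaton reads a step word letter by letter,
its state after the word `w` being `run step w : Option State` (`none` = the word was killed).
If `R` is a set of states containing the initial state `[]` and closed under the transitions, and
`v : State → ℕ`, `v ≥ 1` on `R`, satisfies the **sub-invariance** (Collatz–Wielandt) inequality
`D · Σ_d v(step a d) ≤ N · v(a)` on `R`, then the number of surviving words of length `n` is at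
most `(N/D)ⁿ v([])` (`card_liveWords_mul_pow_le`). States are step words (`List Step`) throughout
(the automata we use remember a suffix of the input).

## Contents (namespace `Literature.Probability.RandomPlanarGeometry.SAW.WordAutomaton`)

* `run step w`, `run_nil`, `run_append_singleton`;
* `liveWords step n` (words of length `n` with `run ≠ none`), `phi`, `weightSum`;
* `sum_words_succ` (`Σ_{|w|=n+1} f w = Σ_{|w|=n} Σ_d f (w ++ [d])`);
* `Certificate step R v N D` (the hypotheses above, as a structure) and the bound
  `card_liveWords_mul_pow_le : #(liveWords n) · Dⁿ ≤ Nⁿ · v []`.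

## References

* A. Pönitz, P. Tittmann, *Improved upper bounds for self-avoiding walks in ℤᵈ*, Electron. J.
  Combin. 7 (2000) R21, §3 (power iteration on the automaton = largest eigenvalue).
* S. E. Alm, *Upper bounds for the connective constant of self-avoiding walks*, Combin. Probab.
  Comput. 2 (1993) 115–136.
* L. Collatz, *Einschließungssatz für die charakteristischen Zahlen von Matrizen*, Math. Z. 48
  (1942) 221–226 (the quotient bound `λ_max ≤ max_i (Av)_i / v_i` for `v > 0`).
-/

open Finset
open scoped BigOperators

namespace Literature.Probability.RandomPlanarGeometry.SAW

/-! ### Splitting off the last letter of a word -/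

/-- `words (n+1)` is obtained from `words n` by appending one letter. [folklore] -/
theorem words_succ (n : ℕ) :
    words (n + 1) = (words n).biUnion fun w => (univ : Finset Step).image fun d => w ++ [d] := by
  ext w
  simp only [mem_words, mem_biUnion, mem_image, mem_univ, true_and]
  constructor
  · intro h
    refine ⟨w.take n, by simp [h], w[n]'(by omega), ?_⟩
    conv_rhs => rw [← List.take_append_drop n w]
    rw [List.drop_eq_getElem_cons (by omega), List.drop_of_length_le (by omega)]
  · rintro ⟨w', hw', d, rfl⟩
    simp [hw']

/-- **Last-letter decomposition of sums over words**:
`Σ_{|w| = n+1} f(w) = Σ_{|w| = n} Σ_d f(w ++ [d])`. [folklore] -/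
theorem sum_words_succ {M : Type*} [AddCommMonoid M] (n : ℕ) (f : List Step → M) :
    ∑ w ∈ words (n + 1), f w = ∑ w ∈ words n, ∑ d : Step, f (w ++ [d]) := by
  rw [words_succ, sum_biUnion]
  · refine sum_congr rfl fun w _ => ?_
    rw [sum_image]
    intro d _ d' _ h
    simpa using List.append_cancel_left h
  · intro w _ w' _ hne
    simp only [Function.onFun]
    rw [Finset.disjoint_left]
    intro u hu hu'
    simp only [mem_image, mem_univ, true_and] at hu hu'
    obtain ⟨d, rfl⟩ := hu
    obtain ⟨d', h⟩ := hu'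
    have := congrArg List.dropLast h
    simp only [List.dropLast_concat] at this
    exact hne this.symm

namespace WordAutomaton

variable (step : List Step → Step → Option (List Step))

/-! ### Runs -/

/-- The state of the automaton `step` after reading `w` from the initial state `[]`
(`none` if the word was killed on the way). [cite: PonitzTittmann2000, §2] -/
def run (w : List Step) : Option (List Step) :=
  w.foldl (fun o d => o.bind fun a => step a d) (some [])

/-- The run on the empty word is the initial state. [folklore] -/
@[simp] theorem run_nil : run step [] = some [] := rfl

/-- Reading one more letter. [folklore] -/
theorem run_append_singleton (w : List Step) (d : Step) :
    run step (w ++ [d]) = (run step w).bind fun a => step a d := by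
  simp [run, List.foldl_append]

/-- The words of length `n` that survive the automaton. [cite: PonitzTittmann2000, §3] -/
def liveWords (n : ℕ) : Finset (List Step) := (words n).filter fun w => run step w ≠ none

/-- Membership in `liveWords`. [folklore] -/
@[simp] theorem mem_liveWords {n : ℕ} {w : List Step} :
    w ∈ liveWords step n ↔ w.length = n ∧ run step w ≠ none := by
  simp [liveWords]

/-! ### Certificates and the weighted count -/

/-- A **Collatz–Wielandt certificate** for the automaton `step` with ratio `N/D`: a set of states
`R ∋ []` closed under the transitions and a weight `v ≥ 1` on `R` with
`D · Σ_d v(step a d) ≤ N · v a` for `a ∈ R`. [cite: PonitzTittmann2000, §3] -/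
structure Certificate (R : Set (List Step)) (v : List Step → ℕ) (N D : ℕ) : Prop where
  /-- the initial state is in `R` -/
  nil_mem : [] ∈ R
  /-- `R` is closed under the transitions -/
  closed : ∀ a ∈ R, ∀ d b, step a d = some b → b ∈ R
  /-- the weight is positive on `R` -/
  one_le : ∀ a ∈ R, 1 ≤ v a
  /-- sub-invariance of the weight -/
  subinv : ∀ a ∈ R, D * ∑ d : Step, ((step a d).map v).getD 0 ≤ N * v a

variable {step}

/-- The weight of an optional state (`0` for a killed run). [folklore] -/
def phi (v : List Step → ℕ) : Option (List Step) → ℕ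
  | none => 0
  | some a => v a

/-- `phi v (some a) = v a`. [folklore] -/
@[simp] theorem phi_some (v : List Step → ℕ) (a : List Step) : phi v (some a) = v a := rfl

/-- `phi v none = 0`. [folklore] -/
@[simp] theorem phi_none (v : List Step → ℕ) : phi v none = 0 := rfl

/-- `phi` of an `Option.map`-style expression. [folklore] -/
theorem phi_eq_getD (v : List Step → ℕ) (o : Option (List Step)) : phi v o = (o.map v).getD 0 := by
  cases o <;> rfl

/-- The total weight `Φₙ = Σ_{|w| = n} v(run w)` of the runs of length `n`. [cite: PonitzTittmann2000, §3] -/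
def weightSum (step : List Step → Step → Option (List Step)) (v : List Step → ℕ) (n : ℕ) : ℕ :=
  ∑ w ∈ words n, phi v (run step w)

/-- `Φ₀ = v([])`. [folklore] -/
theorem weightSum_zero (v : List Step → ℕ) : weightSum step v 0 = v [] := by
  simp [weightSum, words]

/-- Surviving runs stay in the closed set `R`. [folklore] -/
theorem run_mem {R : Set (List Step)} {v : List Step → ℕ} {N D : ℕ} (hc : Certificate step R v N D)
    (w : List Step) {a : List Step} (h : run step w = some a) : a ∈ R := by
  induction w using List.reverseRecOn generalizing a with
  | nil => simp only [run_nil, Option.some.injEq] at h; subst h; exact hc.nil_mem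
  | append_singleton w d ih =>
    rw [run_append_singleton] at h
    cases hw : run step w with
    | none => simp [hw] at h
    | some a' => rw [hw, Option.bind_some] at h; exact hc.closed a' (ih hw) d a h

/-- **One step of the weighted count**: `D · Φₙ₊₁ ≤ N · Φₙ`. [cite: PonitzTittmann2000, §3] -/
theorem mul_weightSum_succ_le {R : Set (List Step)} {v : List Step → ℕ} {N D : ℕ}
    (hc : Certificate step R v N D) (n : ℕ) :
    D * weightSum step v (n + 1) ≤ N * weightSum step v n := by
  rw [weightSum, weightSum, sum_words_succ, mul_sum, mul_sum]
  refine sum_le_sum fun w _ => ?_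
  cases hw : run step w with
  | none => simp [run_append_singleton, hw]
  | some a =>
    have ha : a ∈ R := run_mem hc w hw
    simp only [run_append_singleton, hw, Option.bind_some, phi_eq_getD]
    exact hc.subinv a ha

/-- **`Dⁿ Φₙ ≤ Nⁿ v([])`**. [cite: PonitzTittmann2000, §3] -/
theorem pow_mul_weightSum_le {R : Set (List Step)} {v : List Step → ℕ} {N D : ℕ}
    (hc : Certificate step R v N D) (n : ℕ) :
    D ^ n * weightSum step v n ≤ N ^ n * v [] := by
  induction n with
  | zero => simp [weightSum_zero]
  | succ n ih =>
    calc D ^ (n + 1) * weightSum step v (n + 1)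
        = D ^ n * (D * weightSum step v (n + 1)) := by ring
      _ ≤ D ^ n * (N * weightSum step v n) := Nat.mul_le_mul_left _ (mul_weightSum_succ_le hc n)
      _ = N * (D ^ n * weightSum step v n) := by ring
      _ ≤ N * (N ^ n * v []) := Nat.mul_le_mul_left _ ih
      _ = N ^ (n + 1) * v [] := by ring

/-- The number of surviving words is at most the weighted count. [folklore] -/
theorem card_liveWords_le_weightSum {R : Set (List Step)} {v : List Step → ℕ} {N D : ℕ}
    (hc : Certificate step R v N D) (n : ℕ) :
    (liveWords step n).card ≤ weightSum step v n := by
  rw [liveWords, card_eq_sum_ones, sum_filter, weightSum]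
  refine sum_le_sum fun w _ => ?_
  split_ifs with h
  · cases hw : run step w with
    | none => exact absurd hw h
    | some a => exact hc.one_le a (run_mem hc w hw)
  · exact Nat.zero_le _

/-- **Collatz–Wielandt bound for the surviving words**: `#(liveWords n) · Dⁿ ≤ Nⁿ · v([])`.
[cite: PonitzTittmann2000, §3] -/
theorem card_liveWords_mul_pow_le {R : Set (List Step)} {v : List Step → ℕ} {N D : ℕ}
    (hc : Certificate step R v N D) (n : ℕ) :
    (liveWords step n).card * D ^ n ≤ N ^ n * v [] :=
  calc (liveWords step n).card * D ^ n ≤ weightSum step v n * D ^ n :=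
        Nat.mul_le_mul_right _ (card_liveWords_le_weightSum hc n)
    _ = D ^ n * weightSum step v n := mul_comm _ _
    _ ≤ N ^ n * v [] := pow_mul_weightSum_le hc n

/-- If every self-avoiding word survives, `cₙ · Dⁿ ≤ Nⁿ · v([])`. [cite: PonitzTittmann2000, §3] -/
theorem count_mul_pow_le {R : Set (List Step)} {v : List Step → ℕ} {N D : ℕ}
    (hc : Certificate step R v N D) (hsaw : ∀ w, IsSAW w → run step w ≠ none) (n : ℕ) :
    count n * D ^ n ≤ N ^ n * v [] := by
  refine le_trans (Nat.mul_le_mul_right _ ?_) (card_liveWords_mul_pow_le hc n)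
  rw [count_eq_card_sawWords]
  refine card_le_card fun w hw => ?_
  rw [mem_sawWords] at hw
  exact (mem_liveWords step).2 ⟨hw.1, hsaw w hw.2⟩

end WordAutomaton

end Literature.Probability.RandomPlanarGeometry.SAW
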